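import Literature.Analysis.FluidPDE.QuasiSelfSimilarMoveSP13Cert
import Literature.Analysis.FluidPDE.QuasiSelfSimilarMoveSC
import HarnessLib

/-!
# Straight move, phase 13: kernel checks (3/3)

Topic `Literature/Analysis/FluidPDE`. Emitted data / kernel certificates of the explicit straight generating
move (`S`) in the typed-chain model, under the contract of `PlanarGeneratorAssembly.lean`
(`acm_compatible_blocks_of_slots`). Generated by the author's emitter from the exact rational design;
no named facts, every theorem is decided in the kernel or assembled from decided chunks. [folklore]

## References

* G. Alberti, G. Crippa, A. L. Mazzucato, *Exponential self-similar mixing by incompressible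
  flows*, J. Amer. Math. Soc. 32 (2019), 445–490, §8 (arXiv:1605.02090).
-/

noncomputable section

namespace Literature.Analysis.FluidPDE.QuasiSelfSimilar.MoveS

open PlanarKinematics QuasiSelfSimilar

set_option maxHeartbeats 4000000 in
/-- Kernel check of box separation rows, nodes `80 ≤ k < 120`. [folklore] -/
theorem P13_sep_c2 : ∀ k, 80 ≤ k → k < 120 → P13.sepRowB k = true := by decide +kernel

set_option maxHeartbeats 4000000 in
/-- Kernel check of box separation rows, nodes `120 ≤ k < 133`. [folklore] -/
theorem P13_sep_c3 : ∀ k, 120 ≤ k → k < 133 → P13.sepRowB k = true := by decide +kernel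

set_option maxHeartbeats 4000000 in
/-- Kernel check of junction agreement, nodes `0 ≤ k < 40`. [folklore] -/
theorem P13_agr_c0 : ∀ k, 0 ≤ k → k < 40 → P13.agreeAtB k = true := by decide +kernel

set_option maxHeartbeats 4000000 in
/-- Kernel check of junction agreement, nodes `40 ≤ k < 80`. [folklore] -/
theorem P13_agr_c1 : ∀ k, 40 ≤ k → k < 80 → P13.agreeAtB k = true := by decide +kernel

set_option maxHeartbeats 4000000 in
/-- Kernel check of junction agreement, nodes `80 ≤ k < 120`. [folklore] -/
theorem P13_agr_c2 : ∀ k, 80 ≤ k → k < 120 → P13.agreeAtB k = true := by decide +kernel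

set_option maxHeartbeats 4000000 in
/-- Kernel check of junction agreement, nodes `120 ≤ k < 133`. [folklore] -/
theorem P13_agr_c3 : ∀ k, 120 ≤ k → k < 133 → P13.agreeAtB k = true := by decide +kernel

end Literature.Analysis.FluidPDE.QuasiSelfSimilar.MoveS

end
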